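import Mathlib
import Summits.Ventures.PercRepro2.SwOutJunctionH1Base

/-!
# The canonical base of a core-kind point, core form (blind cell PercRepro2, night-4 g33,
2026-08-28; proofs/NIGHT4-G33.md §3)

g13's `coreBase_of_coreKind` / `coreReal_coreBaseOf` (SwOutJunctionH1Base) depend on the
principal side `Q` only through two facts — the two sides of the extended hull are disjoint
(`redExt_disjoint_blueExt`) and the extended hull lies in `U` — so they are restated with exactly
these two hypotheses (**`coreBase_of_coreKind_core`**, **`coreReal_coreBaseOf_core`**); the
proofs are g13's verbatim.  The general doubly typed side re-enters through
`redExt_disjoint_blueExt_g` (SwOutJunctionH1GTypedSides).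
-/

namespace Summit.Ventures.PercRepro2

namespace LocRows

open Hull

variable {V : Type*} {E : Type*} [Fintype E]

open scoped Classical

variable {ends : E → Sym2 V} {U : Set V} {h u : V}

/-- **The canonical base of a core-kind point is a core base on its arms** (core form: the two
sides of the extended hull disjoint, the extended hull inside `U`; g13's proof verbatim). -/
theorem coreBase_of_coreKind_core (hhu : h ≠ u) (hloop_h : ∀ e, ends e ≠ s(h, h))
    (hloop_u : ∀ e, ends e ≠ s(u, u)) (hnadj : ∀ e, ends e ≠ s(h, u))
    (hH1 : H1 ends U h u) {ζ : Config E} (hk : CoreKind ends U h u ζ)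
    (hdisj : ∀ x, x ∈ redExt ends h u ζ → x ∈ blueExt ends ζ h u → False)
    (hHU : extHull ends ζ h u ⊆ U) :
    CoreBase ends (coreBaseOf ends ζ h u) h u (extHull ends ζ h u)
      (fun P : armsC ends h u ζ => P.1) (fun P => pureC ends h P.1) := by
  have hnoRB : ∀ e x y, ends e = s(x, y) → x ∈ redExt ends h u ζ → y ∈ blueExt ends ζ h u →
      False := fun e x y hxy hx hy => no_edge_redExt_blueExt hdisj hxy hx hy
  -- the blue colouring's sides are the sides exchanged
  have hdisj' : ∀ x, x ∈ redExt ends h u (blue ζ) → x ∈ blueExt ends (blue ζ) h u → False := by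
    intro x hxR hxB
    rw [redExt_blue] at hxR
    rw [blueExt_blue] at hxB
    exact hdisj x hxB hxR
  have hHU' : extHull ends (blue ζ) h u ⊆ U := by rw [extHull_blue]; exact hHU
  exact
  { hne := hhu
    bdry_blue := by
      intro e x y hxy hxH hyH
      have hyB : y ∉ blueExt ends ζ h u := fun h' => hyH (blueExt_subset_extHull h')
      rw [extHull_eq] at hxH
      rcases hxH with ((rfl | rfl) | hxR) | hxB
      · exfalso
        cases he : ζ e with
        | true => exact hyH (Or.inl (Or.inl (mem_cluster_of_edge (mem_cluster_self _ _ _) he hxy)))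
        | false =>
          have he' : blue ζ e = true := by rw [blue_eq_true_iff]; exact he
          exact hyH (Or.inl (Or.inr (mem_cluster_of_edge (mem_cluster_self _ _ _) he' hxy)))
      · exfalso
        cases he : ζ e with
        | true => exact hyH (Or.inr (Or.inl (mem_cluster_of_edge (mem_cluster_self _ _ _) he hxy)))
        | false =>
          have he' : blue ζ e = true := by rw [blue_eq_true_iff]; exact he
          exact hyH (Or.inr (Or.inr (mem_cluster_of_edge (mem_cluster_self _ _ _) he' hxy)))
      · rw [coreBaseOf_apply_of_notMem hxy (fun h' => hdisj x hxR h') hyB]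
        cases he : ζ e with
        | true => exact absurd (mem_extHull_of_red_of_mem_redExt hxy hxR he) hyH
        | false => rfl
      · rw [coreBaseOf_apply_of_mem hxy hxB]
        cases he : ζ e with
        | true => rfl
        | false =>
          exfalso
          have hxR' : x ∈ redExt ends h u (blue ζ) := by rw [redExt_blue]; exact hxB
          have he' : blue ζ e = true := by rw [blue_eq_true_iff]; exact he
          have := mem_extHull_of_red_of_mem_redExt hxy hxR' he'
          rw [extHull_blue] at this
          exact hyH this
    arm_sub := fun P x hx => armsC_subset P.2 x hx
    arm_nonempty := fun P => armsC_nonempty P.2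
    arm_disj := fun P P' hne x hx => armsC_disjoint P.2 P'.2 (fun h' => hne (Subtype.ext h')) x hx
    arm_cover := by
      intro x hxH hxh hxu
      obtain ⟨P, hP, hxP⟩ := exists_armsC_of_mem hhu hxH hxh hxu
      exact ⟨⟨P, hP⟩, hxP⟩
    no_cross := fun P P' hne e x y hxy hx hy =>
      armsC_no_cross P.2 P'.2 (fun h' => hne (Subtype.ext h')) hxy hx hy
    h_edges := by
      intro e x hxe
      have hxh : x ≠ h := fun h' => hloop_h e (by rw [hxe, h'])
      have hxu : x ≠ u := fun h' => hnadj e (by rw [hxe, h'])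
      have hxH : x ∈ extHull ends ζ h u := by
        cases he : ζ e with
        | true => exact Or.inl (Or.inl (mem_cluster_of_edge (mem_cluster_self _ _ _) he hxe))
        | false =>
          have he' : blue ζ e = true := by rw [blue_eq_true_iff]; exact he
          exact Or.inl (Or.inr (mem_cluster_of_edge (mem_cluster_self _ _ _) he' hxe))
      obtain ⟨P, hP, hxP⟩ := exists_armsC_of_mem hhu hxH hxh hxu
      exact ⟨⟨P, hP⟩, hxP⟩
    h_red := by
      intro e x hxe
      have hxh : x ≠ h := fun h' => hloop_h e (by rw [hxe, h'])
      have hxu : x ≠ u := fun h' => hnadj e (by rw [hxe, h'])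
      cases he : ζ e with
      | true =>
        have hxR : x ∈ redExt ends h u ζ := by
          rw [mem_redExt_iff]
          exact ⟨Or.inl (mem_cluster_of_edge (mem_cluster_self _ _ _) he hxe), hxh, hxu⟩
        rw [coreBaseOf_apply_of_notMem hxe h_notMem_blueExt (fun h' => hdisj x hxR h'), he]
      | false =>
        have he' : blue ζ e = true := by rw [blue_eq_true_iff]; exact he
        have hxB : x ∈ blueExt ends ζ h u := by
          rw [mem_blueExt_iff]
          exact ⟨Or.inl (mem_cluster_of_edge (mem_cluster_self _ _ _) he' hxe), hxh, hxu⟩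
        rw [coreBaseOf_apply_of_mem (ends_swap hxe) hxB, he]
        rfl
    u_edges := by
      intro e x hxe
      have hxu : x ≠ u := fun h' => hloop_u e (by rw [hxe, h'])
      have hxh : x ≠ h := fun h' => hnadj e (by rw [hxe, h', Sym2.eq_swap])
      have hxH : x ∈ extHull ends ζ h u := by
        cases he : ζ e with
        | true => exact Or.inr (Or.inl (mem_cluster_of_edge (mem_cluster_self _ _ _) he hxe))
        | false =>
          have he' : blue ζ e = true := by rw [blue_eq_true_iff]; exact he
          exact Or.inr (Or.inr (mem_cluster_of_edge (mem_cluster_self _ _ _) he' hxe))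
      obtain ⟨P, hP, hxP⟩ := exists_armsC_of_mem hhu hxH hxh hxu
      exact ⟨⟨P, hP⟩, hxP⟩
    u_red := by
      intro e x hxe
      have hxu : x ≠ u := fun h' => hloop_u e (by rw [hxe, h'])
      have hxh : x ≠ h := fun h' => hnadj e (by rw [hxe, h', Sym2.eq_swap])
      cases he : ζ e with
      | true =>
        have hxR : x ∈ redExt ends h u ζ := by
          rw [mem_redExt_iff]
          exact ⟨Or.inr (mem_cluster_of_edge (mem_cluster_self _ _ _) he hxe), hxh, hxu⟩
        rw [coreBaseOf_apply_of_notMem hxe u_notMem_blueExt (fun h' => hdisj x hxR h'), he]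
      | false =>
        have he' : blue ζ e = true := by rw [blue_eq_true_iff]; exact he
        have hxB : x ∈ blueExt ends ζ h u := by
          rw [mem_blueExt_iff]
          exact ⟨Or.inr (mem_cluster_of_edge (mem_cluster_self _ _ _) he' hxe), hxh, hxu⟩
        rw [coreBaseOf_apply_of_mem (ends_swap hxe) hxB, he]
        rfl
    u_hadj := by
      rcases hk.1 with hu | hu
      · obtain ⟨P, hP, ⟨ey, y, hey, hyP⟩, e, x, hux, _, hxP⟩ := exists_harm_adj_u hhu hnadj hu
        exact ⟨⟨P, hP⟩, fun hp => hp ey y hey hyP, e, x, hux, hxP⟩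
      · obtain ⟨P, hP, ⟨ey, y, hey, hyP⟩, e, x, hux, _, hxP⟩ :=
          exists_harm_adj_u (η := blue ζ) hhu hnadj hu
        rw [armsC_blue] at hP
        exact ⟨⟨P, hP⟩, fun hp => hp ey y hey hyP, e, x, hux, hxP⟩
    harm_conn := by
      intro P hnp x hx
      have hy : ∃ e y, ends e = s(h, y) ∧ y ∈ P.1 := by
        by_contra hno
        exact hnp fun e y hey hyP => hno ⟨e, y, hey, hyP⟩
      rcases armsC_subset_side hnoRB P.2 with hPR | hPB
      · rw [insideConfig_coreBaseOf_of_subset_red hPR (Or.inl rfl) hdisj]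
        exact harm_conn_red hH1 hHU hdisj P.2 hPR hy x hx
      · rw [insideConfig_coreBaseOf_of_subset_blue hPB hloop_h]
        have hP' : P.1 ∈ armsC ends h u (blue ζ) := by rw [armsC_blue]; exact P.2
        have hPR' : P.1 ⊆ redExt ends h u (blue ζ) := by rw [redExt_blue]; exact hPB
        exact harm_conn_red hH1 hHU' hdisj' hP' hPR' hy x hx
    pure_conn := by
      intro P hp x hx
      rcases armsC_subset_side hnoRB P.2 with hPR | hPB
      · rw [insideConfig_coreBaseOf_of_subset_red hPR (Or.inr rfl) hdisj]
        exact pure_conn_red P.2 hPR hp x hx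
      · rw [insideConfig_coreBaseOf_of_subset_blue hPB hloop_u]
        have hP' : P.1 ∈ armsC ends h u (blue ζ) := by rw [armsC_blue]; exact P.2
        have hPR' : P.1 ⊆ redExt ends h u (blue ζ) := by rw [redExt_blue]; exact hPB
        exact pure_conn_red hP' hPR' hp x hx
    pure_no_h := fun P hp e x hxe => hp e x hxe }

/-- **A point whose two sides are disjoint is the cube point of its canonical base given by its
red arms** (core form; g13's proof verbatim). -/
theorem coreReal_coreBaseOf_core (hhu : h ≠ u) {ζ : Config E}
    (hdisj : ∀ x, x ∈ redExt ends h u ζ → x ∈ blueExt ends ζ h u → False) :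
    coreReal ends (fun P : armsC ends h u ζ => P.1) (coreBaseOf ends ζ h u) (omegaOf ends h u ζ) =
      ζ := by
  have hnoRB : ∀ e x y, ends e = s(x, y) → x ∈ redExt ends h u ζ → y ∈ blueExt ends ζ h u →
      False := fun e x y hxy hx hy => no_edge_redExt_blueExt hdisj hxy hx hy
  have key : armsFalseC (fun P : armsC ends h u ζ => P.1) (omegaOf ends h u ζ) =
      blueExt ends ζ h u := by
    ext x
    constructor
    · rintro ⟨P, hP, hx⟩
      simp only [omegaOf, decide_eq_false_iff_not] at hP
      rcases armsC_subset_side hnoRB P.2 with hPR | hPB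
      · exact absurd hPR hP
      · exact hPB hx
    · intro hxB
      have hxH := blueExt_subset_extHull hxB
      obtain ⟨_, hxh, hxu⟩ := mem_blueExt_iff.1 hxB
      obtain ⟨P, hP, hxP⟩ := exists_armsC_of_mem hhu hxH hxh hxu
      refine ⟨⟨P, hP⟩, ?_, hxP⟩
      simp only [omegaOf, decide_eq_false_iff_not]
      intro hPR
      exact hdisj x (hPR hxP) hxB
  unfold coreReal coreBaseOf
  rw [key, Hull.flip_flip]

end LocRows

end Summit.Ventures.PercRepro2
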